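import Summits.CriticalPhenomena.PercolationContinuityZ3.Theorems.Transplant.PlanarCells2SArm
import Summits.CriticalPhenomena.PercolationContinuityZ3.Theorems.Transplant.PlanarCellsSep
import HarnessLib

/-!
# STAGGERED two-unit planar cells `PCells2S` ((R-22) K-G geometry of record): SEPARATIONS — the `PCells2S` twin of `PlanarCells2Sep`
# over the staggered centres and the narrow arms of record `BtwNS` ((R-29)/J7)

WAVE-1 Geom re-base (typer p3-g15, lead 2026-08-22T21:20:50Z; order stmt-g19's GEOM-REBASE-PRECENSUS §D; sieve p5-g15).  WHAT CHANGES w.r.t. hp-8 g27: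
(J6) two macro-vertices are no longer separated coordinatewise — along `a` the centre difference is `20·r_a·Δv_a + c_⊥·Δv_⊥`, across `20·r_⊥·Δv_⊥ +
c_a·Δv_a` (`cenS_sub_along/oth`); p5-g15's `cenS_sep'` (`≥ 19 r_j` somewhere) is too weak along an axis (a zone reaches level `15r − 10s`, the row
neighbour's cube starts at `≥ 14r`).  Engine `sep_small_or_far a u x`: EITHER both index gaps are `≤ 1` (`small_cases`: finite case analysis, `omega`
per leaf with the two identities) OR the centres are `≥ 38 r` apart in a coordinate.  (J7) The narrow between-boxes are the SHRUNK `BtwNS` of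
PlanarCells2SArm: `BtwNS_disjoint_BtwNS` (the cover's `SepGeom₂.Btw_disjoint_Btw` field) holds for every pair but the same / reversed edge; the wide
`PCells2.Btw_disjoint_Btw` and `BtwN_disjoint_BtwN` are FALSE under the stagger (witness in PlanarCells2SArm) and are not restated.  (J5) the `rev`
identities are false and not restated.  (R-27) far regions are unions `EfarS = Btw ∪ Q (v+δ)` (p5-g15) / `FarNS = BtwNS ∪ QNS v δ 1`; far separations are
pairs of one-box facts.  The fresh rows `farAN/farAS` get their re-cut in the EfarN2/StairLev twin.  Statements in explicit-application form `PCells2S.X P …`.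
builds on p205010 (kernel theorem, internal audit signed; external expert review pending) — nothing here uses p205010 or claims anything about the open node.
Lane `prim-bschramm`, seat `prim-bschramm-p3` (gen 15; N2 design owner); helper file (`--supports stmt-CriticalPhenomena-4575 --as helper`).
[cite: KozmaNitzan2024, §4 pp. 25–26 (the cells Q_v, M_v, E_{v,x}, E^far_{v,x}, H^j_{v,x} and their separation), p. 30]
-/


noncomputable section

namespace Summit.CriticalPhenomena.PercolationContinuityZ3.Theorems

namespace Transplant

open Literature.Probability.Percolation Literature.Probability.LatticeModels SimpleGraph GadgetSystem Contour
open Literature.Probability.Percolation.KozmaNitzan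
open Literature.Probability.Percolation.KozmaNitzan.Cells (oth oth_ne sgOf sgOf_sign stepVec_apply_fst stepVec_apply_oth eq_oth_of_ne oth_oth
  eq_of_coords)
open PCells (mem_psBox_iff exists_adj_of_mem_Icc)

namespace PCells2S

variable (P : PCells2S)

/-! ## §1 The engine: centre differences and the small-or-far dichotomy -/

/-- Along axis `a`: `cenS x a − cenS u a = 20·r_a·(x a − u a) + c (oth a)·(x ⊥ − u ⊥)`. [this work] -/
theorem cenS_sub_along (a : Fin 2) (u x : Site 2) :
    P.cenS x a - P.cenS u a = 20 * (P.r a : ℤ) * (x a - u a) + P.c (oth a) * (x (oth a) - u (oth a)) := by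
  simp only [cenS_apply]; ring

/-- Across axis `a`: `cenS x ⊥ − cenS u ⊥ = 20·r_⊥·(x ⊥ − u ⊥) + c a·(x a − u a)`. [this work] -/
theorem cenS_sub_oth (a : Fin 2) (u x : Site 2) :
    P.cenS x (oth a) - P.cenS u (oth a) = 20 * (P.r (oth a) : ℤ) * (x (oth a) - u (oth a)) + P.c a * (x a - u a) := by
  simp only [cenS_apply, oth_oth]; ring

/-- `|20 r n + c n'| ≥ 19 r |n|` when `|n'| ≤ |n|` and `0 ≤ c ≤ r`. [folklore] -/
theorem abs_gap_ge {r c n n' : ℤ} (hc0 : 0 ≤ c) (hcr : c ≤ r) (h : |n'| ≤ |n|) : 19 * r * |n| ≤ |20 * r * n + c * n'| := by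
  have hr : 0 ≤ r := hc0.trans hcr
  have h1 : |c * n'| ≤ r * |n| := by
    rw [abs_mul, abs_of_nonneg hc0]; exact mul_le_mul hcr h (abs_nonneg _) hr
  have h2 : |20 * r * n| = 20 * r * |n| := by rw [abs_mul, abs_of_nonneg (by positivity)]
  have h3 := abs_sub_abs_le_abs_sub (20 * r * n) (-(c * n'))
  rw [sub_neg_eq_add, abs_neg] at h3
  nlinarith

/-- **SMALL OR FAR**: both index gaps are `≤ 1` in absolute value, or the staggered centres are `≥ 38 r` apart across or along. [this work] -/
theorem sep_small_or_far (a : Fin 2) (u x : Site 2) :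
    (|x a - u a| ≤ 1 ∧ |x (oth a) - u (oth a)| ≤ 1) ∨ 38 * (P.r (oth a) : ℤ) ≤ |P.cenS x (oth a) - P.cenS u (oth a)| ∨
      38 * (P.r a : ℤ) ≤ |P.cenS x a - P.cenS u a| := by
  set m : ℤ := x a - u a with hm
  set k : ℤ := x (oth a) - u (oth a) with hk
  by_cases hm1 : |m| ≤ 1
  · by_cases hk1 : |k| ≤ 1
    · exact Or.inl ⟨hm1, hk1⟩
    · right; left
      rw [P.cenS_sub_oth a u x]
      rcases le_total |m| |k| with hle | hle
      · have := abs_gap_ge (P.c_nonneg a) (P.c_le_r a (oth a)) hle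
        have hr : (0 : ℤ) ≤ P.r (oth a) := by positivity
        nlinarith
      · omega
  · right
    rcases le_total |k| |m| with hle | hle
    · right
      rw [P.cenS_sub_along a u x]
      have := abs_gap_ge (P.c_nonneg (oth a)) (P.c_le_r (oth a) a) hle
      have hr : (0 : ℤ) ≤ P.r a := by positivity
      nlinarith
    · left
      rw [P.cenS_sub_oth a u x]
      have := abs_gap_ge (P.c_nonneg a) (P.c_le_r a (oth a)) hle
      have hr : (0 : ℤ) ≤ P.r (oth a) := by positivity
      nlinarith

/-- The small case made explicit: index gaps `m, k ∈ {−1, 0, 1}` and the two centre identities. [this work] -/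
theorem small_cases (a : Fin 2) (u x : Site 2) (hm : |x a - u a| ≤ 1) (hk : |x (oth a) - u (oth a)| ≤ 1) :
    ∃ m k : ℤ, (m = -1 ∨ m = 0 ∨ m = 1) ∧ (k = -1 ∨ k = 0 ∨ k = 1) ∧ x a = u a + m ∧ x (oth a) = u (oth a) + k ∧
      P.cenS x a = P.cenS u a + 20 * (P.r a : ℤ) * m + P.c (oth a) * k ∧
      P.cenS x (oth a) = P.cenS u (oth a) + 20 * (P.r (oth a) : ℤ) * k + P.c a * m := by
  have ea := P.cenS_sub_along a u x
  have eo := P.cenS_sub_oth a u x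
  obtain ⟨hm1, hm2⟩ := abs_le.1 hm
  obtain ⟨hk1, hk2⟩ := abs_le.1 hk
  refine ⟨x a - u a, x (oth a) - u (oth a), by omega, by omega, by omega, by omega, by linarith, by linarith⟩

/-- The standing size facts, packaged for `omega`: `1 ≤ r_j`, `0 ≤ c_i ≤ r_j`, `1 ≤ s_j`, `20 s_j ≤ r_j`. [folklore] -/
theorem size_facts (a : Fin 2) :
    (1 : ℤ) ≤ P.r a ∧ (1 : ℤ) ≤ P.r (oth a) ∧ 0 ≤ P.c a ∧ 0 ≤ P.c (oth a) ∧ P.c a ≤ (P.r (oth a) : ℤ) ∧ P.c (oth a) ≤ (P.r a : ℤ) ∧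
      P.c a ≤ (P.r a : ℤ) ∧ P.c (oth a) ≤ (P.r (oth a) : ℤ) ∧ (1 : ℤ) ≤ P.s a ∧ 20 * (P.s a : ℤ) ≤ P.r a := by
  refine ⟨by exact_mod_cast P.one_le_r a, by exact_mod_cast P.one_le_r (oth a), P.c_nonneg a, P.c_nonneg (oth a), P.c_le_r a (oth a),
    P.c_le_r (oth a) a, P.c_le_r a a, P.c_le_r (oth a) (oth a), by exact_mod_cast P.hs a, by exact_mod_cast P.twenty_mul_s_le_r a⟩

/-! ## §2 Two-vertex separations -/

/-- **Distinct macro-vertices have disjoint cubes.** [cite: KozmaNitzan2024, §4 p. 26 (29)] -/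
theorem Q_disjoint_Q {u x : Site 2} (h : u ≠ x) : Disjoint (PCells2S.Q P u) (PCells2S.Q P x) := by
  rw [Finset.disjoint_left]
  intro t htu htx
  rw [Q, mem_aboxS_iff] at htu htx
  have hua := htu 0; have huo := htu (oth 0); have hxa := htx 0; have hxo := htx (oth 0)
  push_cast at hua huo hxa hxo
  have hsz := P.size_facts 0
  rcases P.sep_small_or_far 0 u x with ⟨hm, hk⟩ | hfar | hfar
  · obtain ⟨m, k, hm3, hk3, hxu, hxu', ea, eo⟩ := P.small_cases 0 u x hm hk
    have hne : ¬(m = 0 ∧ k = 0) := by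
      rintro ⟨rfl, rfl⟩; exact h (eq_of_coords 0 (by omega) (by omega))
    rcases hm3 with rfl | rfl | rfl <;> rcases hk3 with rfl | rfl | rfl <;> omega
  · rcases le_abs.1 hfar with hh | hh <;> omega
  · rcases le_abs.1 hfar with hh | hh <;> omega

/-- **Cells miss the cubes of other macro-vertices.** [cite: KozmaNitzan2024, §4 p. 26] -/
theorem Cell_disjoint_Q {u x : Site 2} (h : u ≠ x) : Disjoint (PCells2S.Cell P u) (PCells2S.Q P x) := by
  rw [Finset.disjoint_left]
  intro t htu htx
  rw [Cell, mem_aboxS_iff] at htu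
  rw [Q, mem_aboxS_iff] at htx
  have hua := htu 0; have huo := htu (oth 0); have hxa := htx 0; have hxo := htx (oth 0)
  push_cast at hua huo hxa hxo
  have hsz := P.size_facts 0
  rcases P.sep_small_or_far 0 u x with ⟨hm, hk⟩ | hfar | hfar
  · obtain ⟨m, k, hm3, hk3, hxu, hxu', ea, eo⟩ := P.small_cases 0 u x hm hk
    have hne : ¬(m = 0 ∧ k = 0) := by
      rintro ⟨rfl, rfl⟩; exact h (eq_of_coords 0 (by omega) (by omega))
    rcases hm3 with rfl | rfl | rfl <;> rcases hk3 with rfl | rfl | rfl <;> omega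
  · rcases le_abs.1 hfar with hh | hh <;> omega
  · rcases le_abs.1 hfar with hh | hh <;> omega

/-- **Stub zones miss all cubes** (the row-neighbour's cube starts at level `15r > 15r − 10s`). [cite: KozmaNitzan2024, §4 p. 26] -/
theorem Zone_disjoint_Q (u : Site 2) (δ : MDir) (x : Site 2) : Disjoint (PCells2S.Zone P u δ) (PCells2S.Q P x) := by
  rw [Finset.disjoint_left]
  intro t htZ htQ
  rw [Zone, mem_psBox_iff] at htZ
  rw [Q, mem_aboxS_iff] at htQ
  obtain ⟨⟨h1, h2⟩, h3, h4⟩ := htZ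
  have hxa := htQ δ.1; have hxo := htQ (oth δ.1)
  push_cast at hxa hxo h1 h2 h3 h4
  have hsz := P.size_facts δ.1
  rcases P.sep_small_or_far δ.1 u x with ⟨hm, hk⟩ | hfar | hfar
  · obtain ⟨m, k, hm3, hk3, hxu, hxu', ea, eo⟩ := P.small_cases δ.1 u x hm hk
    rcases hm3 with rfl | rfl | rfl <;> rcases hk3 with rfl | rfl | rfl <;> rcases sgOf_sign δ with hs | hs <;> rw [hs] at h1 h2 <;> omega
  · rcases le_abs.1 hfar with hh | hh <;> omega
  · rcases sgOf_sign δ with hs | hs <;> rw [hs] at h1 h2 <;> rcases le_abs.1 hfar with hh | hh <;> omega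

/-- **Cubes and (wide) between-boxes are disjoint** — any cube, any between-box. [cite: KozmaNitzan2024, §4 p. 26] -/
theorem Q_disjoint_Btw (x v : Site 2) (δ : MDir) : Disjoint (PCells2S.Q P x) (PCells2S.Btw P v δ) := by
  rw [Finset.disjoint_left]
  intro t htQ htB
  rw [Q, mem_aboxS_iff] at htQ
  rw [Btw, mem_psBox_iff] at htB
  obtain ⟨⟨h1, h2⟩, h3, h4⟩ := htB
  have hxa := htQ δ.1; have hxo := htQ (oth δ.1)
  push_cast at hxa hxo h1 h2 h3 h4
  have hsz := P.size_facts δ.1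
  rcases P.sep_small_or_far δ.1 v x with ⟨hm, hk⟩ | hfar | hfar
  · obtain ⟨m, k, hm3, hk3, hxu, hxu', ea, eo⟩ := P.small_cases δ.1 v x hm hk
    rcases hm3 with rfl | rfl | rfl <;> rcases hk3 with rfl | rfl | rfl <;> rcases sgOf_sign δ with hs | hs <;> rw [hs] at h1 h2 <;> omega
  · rcases le_abs.1 hfar with hh | hh <;> omega
  · rcases sgOf_sign δ with hs | hs <;> rw [hs] at h1 h2 <;> rcases le_abs.1 hfar with hh | hh <;> omega

/-- Cubes and narrow between-boxes are disjoint. [folklore] -/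
theorem Q_disjoint_BtwN (x v : Site 2) (δ : MDir) : Disjoint (PCells2S.Q P x) (PCells2S.BtwN P v δ) :=
  (P.Q_disjoint_Btw x v δ).mono le_rfl (P.BtwN_subset_Btw v δ)

/-- Cubes and the between-boxes of record are disjoint. [folklore] -/
theorem Q_disjoint_BtwNS (x v : Site 2) (δ : MDir) : Disjoint (PCells2S.Q P x) (PCells2S.BtwNS P v δ) :=
  (P.Q_disjoint_Btw x v δ).mono le_rfl (P.BtwNS_subset_Btw v δ)

/-- The centre of `x` is not in the cell of another macro-vertex. [folklore] -/
theorem cenS_not_mem_Cell {u x : Site 2} (h : u ≠ x) : P.cenS x ∉ PCells2S.Cell P u := fun hc =>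
  Finset.disjoint_left.1 (P.Cell_disjoint_Q h) hc (P.cenS_mem_Q x)

/-- The centre of `x` is in no stub zone. [folklore] -/
theorem cenS_not_mem_Zone (u : Site 2) (δ : MDir) (x : Site 2) : P.cenS x ∉ PCells2S.Zone P u δ := fun hz =>
  Finset.disjoint_left.1 (P.Zone_disjoint_Q u δ x) hz (P.cenS_mem_Q x)

/-- Two directions on the same axis are equal or reversed, according to their signs. [folklore] -/
theorem dir_eq_or_rev {δ δ' : MDir} (hax : δ'.1 = δ.1) : (sgOf δ' = sgOf δ ∧ δ' = δ) ∨ (sgOf δ' = -sgOf δ ∧ δ' = rev δ) := by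
  by_cases h2 : δ'.2 = δ.2
  · left
    exact ⟨by unfold sgOf; rw [h2], Prod.ext hax h2⟩
  · right
    have h2' : δ'.2 = !δ.2 := by
      rcases Bool.eq_false_or_eq_true δ.2 with hb | hb <;> rcases Bool.eq_false_or_eq_true δ'.2 with hb' | hb' <;> simp_all
    refine ⟨?_, Prod.ext hax h2'⟩
    unfold sgOf; rw [h2']; rcases Bool.eq_false_or_eq_true δ.2 with hb | hb <;> simp [hb]

/-- **THE BETWEEN-BOXES OF RECORD OF DIFFERENT (UNDIRECTED) MACRO-EDGES ARE DISJOINT** — the cover's `SepGeom₂.Btw_disjoint_Btw` field under the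
stagger ((R-29)/J7: the across half-width `5r⊥ − 1 − c δ.1` is what the perpendicular-into-a-common-target leaf uses). [cite: KozmaNitzan2024, §4 p. 26 (29)] -/
theorem BtwNS_disjoint_BtwNS {v v' : Site 2} {δ δ' : MDir} (h1 : (v', δ') ≠ (v, δ)) (h2 : (v', δ') ≠ (v + stepVec δ, rev δ)) :
    Disjoint (PCells2S.BtwNS P v δ) (PCells2S.BtwNS P v' δ') := by
  rw [Finset.disjoint_left]
  intro t ht ht'
  rw [mem_BtwNS_iff] at ht ht'
  obtain ⟨⟨ha1, ha2⟩, ha3, ha4⟩ := ht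
  obtain ⟨⟨hb1, hb2⟩, hb3, hb4⟩ := ht'
  have hsz := P.size_facts δ.1
  by_cases hax : δ'.1 = δ.1
  · -- parallel arms
    have hdir := dir_eq_or_rev hax
    rw [hax] at hb1 hb2 hb3 hb4
    have hc' : 0 ≤ P.c δ'.1 ∧ P.c δ'.1 ≤ (P.r (oth δ.1) : ℤ) := ⟨P.c_nonneg _, P.c_le_r _ _⟩
    rcases P.sep_small_or_far δ.1 v v' with ⟨hm, hk⟩ | hfar | hfar
    · obtain ⟨m, k, hm3, hk3, hxu, hxu', ea, eo⟩ := P.small_cases δ.1 v v' hm hk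
      have hsame : ¬(m = 0 ∧ k = 0 ∧ sgOf δ' = sgOf δ) := by
        rintro ⟨rfl, rfl, hs⟩
        rcases hdir with ⟨-, hδ⟩ | ⟨hs', -⟩
        · exact h1 (Prod.ext (show v' = v from eq_of_coords δ.1 (by omega) (by omega)) hδ)
        · rw [hs'] at hs; rcases sgOf_sign δ with h | h <;> rw [h] at hs <;> norm_num at hs
      have hrev : ¬(m = sgOf δ ∧ k = 0 ∧ sgOf δ' = -sgOf δ) := by
        rintro ⟨hm0, rfl, hs⟩
        rcases hdir with ⟨hs', -⟩ | ⟨-, hδ⟩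
        · rw [hs'] at hs; rcases sgOf_sign δ with h | h <;> rw [h] at hs <;> norm_num at hs
        · refine h2 (Prod.ext (eq_of_coords δ.1 ?_ ?_) hδ)
          · show v' δ.1 = (v + stepVec δ) δ.1
            rw [Pi.add_apply, stepVec_apply_fst]; omega
          · show v' (oth δ.1) = (v + stepVec δ) (oth δ.1)
            rw [Pi.add_apply, stepVec_apply_oth, add_zero]; omega
      rcases hm3 with rfl | rfl | rfl <;> rcases hk3 with rfl | rfl | rfl <;> rcases sgOf_sign δ with hs | hs <;>
        rcases sgOf_sign δ' with hs' | hs' <;> rw [hs] at ha1 ha2 hsame hrev <;> rw [hs'] at hb1 hb2 hsame hrev <;> omega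
    · rcases le_abs.1 hfar with hh | hh <;> omega
    · rcases sgOf_sign δ with hs | hs <;> rcases sgOf_sign δ' with hs' | hs' <;> rw [hs] at ha1 ha2 <;> rw [hs'] at hb1 hb2 <;>
        rcases le_abs.1 hfar with hh | hh <;> omega
  · -- perpendicular arms
    have hoth : δ'.1 = oth δ.1 := eq_oth_of_ne hax
    rw [hoth] at hb1 hb2 hb3 hb4
    rw [oth_oth] at hb3 hb4
    rcases P.sep_small_or_far δ.1 v v' with ⟨hm, hk⟩ | hfar | hfar
    · obtain ⟨m, k, hm3, hk3, hxu, hxu', ea, eo⟩ := P.small_cases δ.1 v v' hm hk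
      rcases hm3 with rfl | rfl | rfl <;> rcases hk3 with rfl | rfl | rfl <;> rcases sgOf_sign δ with hs | hs <;>
        rcases sgOf_sign δ' with hs' | hs' <;> rw [hs] at ha1 ha2 <;> rw [hs'] at hb1 hb2 <;> omega
    · rcases sgOf_sign δ' with hs' | hs' <;> rw [hs'] at hb1 hb2 <;> rcases le_abs.1 hfar with hh | hh <;> omega
    · rcases sgOf_sign δ with hs | hs <;> rw [hs] at ha1 ha2 <;> rcases le_abs.1 hfar with hh | hh <;> omega

/-- Twice-narrowed arms of record are disjoint likewise (`BtwN_disjoint_BtwN` itself is false under the stagger, J7). [folklore] -/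
theorem BtwNS₂_disjoint_BtwNS₂ {v v' : Site 2} {δ δ' : MDir} (h1 : (v', δ') ≠ (v, δ)) (h2 : (v', δ') ≠ (v + stepVec δ, rev δ)) :
    Disjoint (PCells2S.BtwNS₂ P v δ) (PCells2S.BtwNS₂ P v' δ') :=
  (P.BtwNS_disjoint_BtwNS h1 h2).mono (P.BtwNS₂_subset_BtwNS v δ) (P.BtwNS₂_subset_BtwNS v' δ')

/-! ## §3 One-vertex and one-step separations (wide boxes; the far regions as unions, (R-27)) -/

/-- Wide between-boxes of DIFFERENT directions at the same macro-vertex are disjoint. [cite: KozmaNitzan2024, §4 p. 26] -/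
theorem Btw_disjoint_Btw_self (v : Site 2) {δ δ' : MDir} (h : δ' ≠ δ) : Disjoint (PCells2S.Btw P v δ') (PCells2S.Btw P v δ) := by
  rw [Finset.disjoint_left]
  intro t htB htE
  rw [Btw, mem_psBox_iff] at htB htE
  obtain ⟨⟨hb1, hb2⟩, hb3, hb4⟩ := htB
  obtain ⟨⟨he1, he2⟩, he3, he4⟩ := htE
  by_cases hax : δ'.1 = δ.1
  · rcases dir_eq_or_rev hax with ⟨-, hδ⟩ | ⟨hsg, -⟩
    · exact h hδ
    · rw [hax, hsg] at hb1
      rcases sgOf_sign δ with hs | hs <;> rw [hs] at hb1 he1 <;> omega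
  · have hoth : δ.1 = oth δ'.1 := eq_oth_of_ne (Ne.symm hax)
    rw [← hoth] at hb3 hb4
    rcases sgOf_sign δ with hs | hs <;> rw [hs] at he1 <;> omega

/-- **The wide between-box of `w → x := w + δw` misses every wide between-box of `x` except the one pointing back** (`cenS_add_stepVec_fst`; the
creep across is irrelevant). [cite: KozmaNitzan2024, §4 p. 26] -/
theorem Btw_disjoint_Btw_add (w : Site 2) {δw du : MDir} (h : du ≠ rev δw) :
    Disjoint (PCells2S.Btw P w δw) (PCells2S.Btw P (w + stepVec δw) du) := by
  rw [Finset.disjoint_left]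
  intro t htB htE
  rw [Btw, mem_psBox_iff] at htB htE
  obtain ⟨⟨hb1, hb2⟩, hb3, hb4⟩ := htB
  obtain ⟨⟨he1, he2⟩, he3, he4⟩ := htE
  have hf := P.cenS_add_stepVec_fst w δw
  have hsz := P.size_facts δw.1
  by_cases hax : du.1 = δw.1
  · rcases dir_eq_or_rev hax with ⟨hsg, -⟩ | ⟨-, hδ⟩
    · rw [hax, hsg, hf] at he1
      rcases sgOf_sign δw with hs | hs <;> rw [hs] at hb2 he1 <;> nlinarith
    · exact h hδ
  · have hoth : du.1 = oth δw.1 := eq_oth_of_ne hax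
    rw [hoth, oth_oth, hf] at he3 he4
    rcases sgOf_sign δw with hs | hs <;> rw [hs] at hb1 hb2 he3 he4 <;> omega

/-- `Btw v δ′` misses the far region `EfarS v δ = Btw v δ ∪ Q (v+δ)` for `δ′ ≠ δ`. [cite: KozmaNitzan2024, §4 p. 26] -/
theorem Btw_disjoint_EfarS (v : Site 2) {δ δ' : MDir} (h : δ' ≠ δ) : Disjoint (PCells2S.Btw P v δ') (PCells2S.EfarS P v δ) :=
  Finset.disjoint_union_right.2 ⟨P.Btw_disjoint_Btw_self v h, (P.Q_disjoint_Btw _ v δ').symm⟩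

/-- **`E_{w,δw} = Btw ∪ Q_x` misses the far regions `EfarS x du` of `x = w + δw` in every direction except back.** [cite: KozmaNitzan2024, §4 p. 26] -/
theorem Ewv_disjoint_EfarS (w : Site 2) {δw du : MDir} (h : du ≠ rev δw) :
    Disjoint (PCells2S.Ewv P w δw) (PCells2S.EfarS P (w + stepVec δw) du) := by
  rw [Ewv, Finset.disjoint_union_left]
  refine ⟨Finset.disjoint_union_right.2 ⟨P.Btw_disjoint_Btw_add w h, (P.Q_disjoint_Btw _ w δw).symm⟩, P.Q_disjoint_EfarS _ du⟩

/-- `Q v` misses the far region of record `FarNS v δ`. [folklore] -/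
theorem Q_disjoint_FarNS (v : Site 2) (δ : MDir) : Disjoint (PCells2S.Q P v) (PCells2S.FarNS P v δ) :=
  (P.Q_disjoint_EfarS v δ).mono le_rfl (P.FarNS_subset_EfarS v δ)

/-- `FarNS x du` misses the cube `Q x` (the same fact from the far side). [folklore] -/
theorem FarNS_disjoint_Q (x : Site 2) (du : MDir) : Disjoint (PCells2S.FarNS P x du) (PCells2S.Q P x) :=
  (P.Q_disjoint_FarNS x du).symm

/-- `Q (v+δ)` misses the between-box of record `BtwNS v δ`. [folklore] -/
theorem Q_add_disjoint_BtwNS (v : Site 2) (δ : MDir) : Disjoint (PCells2S.Q P (v + stepVec δ)) (PCells2S.BtwNS P v δ) :=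
  (P.Q_add_disjoint_Btw v δ).mono le_rfl (P.BtwNS_subset_Btw v δ)

/-- The between-box of record of another direction at the same macro-vertex misses the far region of record. [folklore] -/
theorem BtwNS_disjoint_FarNS (v : Site 2) {δ δ' : MDir} (h : δ' ≠ δ) : Disjoint (PCells2S.BtwNS P v δ') (PCells2S.FarNS P v δ) :=
  (P.Btw_disjoint_EfarS v h).mono (P.BtwNS_subset_Btw v δ') (P.FarNS_subset_EfarS v δ)

/-- `EwvNS_{w,δw}` misses the far regions of record of `w + δw` in every direction except back. [folklore] -/
theorem EwvNS_disjoint_FarNS (w : Site 2) {δw du : MDir} (h : du ≠ rev δw) :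
    Disjoint (PCells2S.EwvNS P w δw) (PCells2S.FarNS P (w + stepVec δw) du) :=
  (P.Ewv_disjoint_EfarS w h).mono (P.EwvNS_subset_Ewv w δw) (P.FarNS_subset_EfarS _ du)

/-- The far regions of record of two different directions at one macro-vertex are disjoint. [folklore] -/
theorem FarNS_disjoint_FarNS (v : Site 2) {δ δ' : MDir} (h : δ' ≠ δ) : Disjoint (PCells2S.FarNS P v δ') (PCells2S.FarNS P v δ) := by
  rw [FarNS, Finset.disjoint_union_left]
  refine ⟨P.BtwNS_disjoint_FarNS v h, Finset.disjoint_union_right.2 ⟨?_, ?_⟩⟩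
  · exact ((P.Q_disjoint_Btw _ v δ).mono (QNS_subset_Q v δ' 1) (P.BtwNS_subset_Btw v δ))
  · refine (P.Q_disjoint_Q ?_).mono (QNS_subset_Q v δ' 1) (QNS_subset_Q v δ 1)
    intro hh
    apply h
    have h1 := congrArg (fun z : Site 2 => z - v) hh
    simp only [add_sub_cancel_left] at h1
    by_cases hax : δ'.1 = δ.1
    · rcases dir_eq_or_rev hax with ⟨-, hδ⟩ | ⟨hsg, -⟩
      · exact hδ
      · have h2 := congrArg (fun z : Site 2 => z δ.1) h1
        simp only [stepVec_apply_fst] at h2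
        have h3 : stepVec δ' δ'.1 = sgOf δ' := stepVec_apply_fst δ'
        rw [hax, h2, hsg] at h3
        rcases sgOf_sign δ with hs | hs <;> rw [hs] at h3 <;> norm_num at h3
    · have h2 := congrArg (fun z : Site 2 => z δ.1) h1
      simp only [stepVec_apply_fst] at h2
      rw [show δ.1 = oth δ'.1 from eq_oth_of_ne (Ne.symm hax), stepVec_apply_oth] at h2
      rcases sgOf_sign δ with hs | hs <;> rw [hs] at h2 <;> norm_num at h2

/-! ## §4 Self-adjacency: every vertex of a box has a lattice neighbour in the box -/

/-- Self-adjacency of `Q_v`. [folklore] -/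
theorem exists_adj_of_mem_Q (v : Site 2) {t : Site 2} (ht : t ∈ PCells2S.Q P v) : ∃ t' ∈ PCells2S.Q P v, (zdGraph 2).Adj t t' :=
  exists_adj_of_mem_Icc 0 (by simp only [Pi.sub_apply, Pi.add_apply, PCells2.hw_apply]; push_cast; have := P.one_le_r 0; omega) ht

/-- Self-adjacency of the wide `Btw`. [folklore] -/
theorem exists_adj_of_mem_Btw (v : Site 2) (δ : MDir) {t : Site 2} (ht : t ∈ PCells2S.Btw P v δ) :
    ∃ t' ∈ PCells2S.Btw P v δ, (zdGraph 2).Adj t t' := by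
  unfold Btw sBox at ht ⊢
  refine exists_adj_of_mem_Icc (oth δ.1) ?_ ht
  simp only [sLo, sHi, if_neg (oth_ne δ.1)]
  have := P.one_le_r (oth δ.1); omega

/-- Self-adjacency of the stubs. [folklore] -/
theorem exists_adj_of_mem_Stub (v : Site 2) (δ : MDir) (j : ℕ) {t : Site 2} (ht : t ∈ PCells2S.Stub P v δ j) :
    ∃ t' ∈ PCells2S.Stub P v δ j, (zdGraph 2).Adj t t' := by
  unfold Stub sBox at ht ⊢
  refine exists_adj_of_mem_Icc (oth δ.1) ?_ ht
  simp only [sLo, sHi, if_neg (oth_ne δ.1)]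
  have := P.one_le_r (oth δ.1); omega

/-- Self-adjacency of the between-box of record `BtwNS` (across side `2(5r⊥ − 1 − c) ≥ 2(4r⊥ − 1) ≥ 1`). [folklore] -/
theorem exists_adj_of_mem_BtwNS (v : Site 2) (δ : MDir) {t : Site 2} (ht : t ∈ PCells2S.BtwNS P v δ) :
    ∃ t' ∈ PCells2S.BtwNS P v δ, (zdGraph 2).Adj t t' := by
  unfold BtwNS sBox at ht ⊢
  refine exists_adj_of_mem_Icc (oth δ.1) ?_ ht
  simp only [sLo, sHi, if_neg (oth_ne δ.1)]
  have := P.one_le_r (oth δ.1); have := P.c_le_r_oth δ; omega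

/-- Self-adjacency of the full corridor. [folklore] -/
theorem exists_adj_of_mem_Hfull (v : Site 2) (δ : MDir) {t : Site 2} (ht : t ∈ PCells2S.Hfull P v δ) :
    ∃ t' ∈ PCells2S.Hfull P v δ, (zdGraph 2).Adj t t' := by
  unfold Hfull sBox at ht ⊢
  refine exists_adj_of_mem_Icc (oth δ.1) ?_ ht
  simp only [sLo, sHi, if_neg (oth_ne δ.1)]
  have := P.one_le_r (oth δ.1); omega


end PCells2S

end Transplant

end Summit.CriticalPhenomena.PercolationContinuityZ3.Theorems

end
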